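import Summits.NavierStokesRegularity.NavierStokesRegularity.Theorems.SymmetryModuliCountFarPastLedger
import Summits.NavierStokesRegularity.NavierStokesRegularity.Theorems.SqueezeCycleExtremalElementExistsEnergy
import Summits.NavierStokesRegularity.NavierStokesRegularity.Theorems.SqueezeCycleExtremalElementExistsRescale
import Literature.Analysis.FluidPDE.LeraySeparationOfEnergyTools

/-!
# Crux `AdaptedFrequencyConverges` (stmt-NavierStokesRegularity-10493), line `birkhoff-recurrent-hull`:
# the far-past GRADIENT ledger of the Type-I ancient mild class `A_C`

Helper file (theorems only) for the registered stub `stub_recurrentPinchedBridge`. For every `C`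
there is `K_E(C)` such that every `u ∈ A_C` (`IsTypeIAncientMild C u`) obeys the scale-invariant
dissipation bound of Albritton–Barker's local Type-I class on EVERY backward cylinder with top
time `t₀ ≤ 0` (final time included): `r⁻¹ ∫_{t₀−r²}^{t₀} ∫_{B_r(x₀)} ‖∇u‖² ≤ K_E`
(`farPast_gradLedger`, registered). This is the `E`-half of "`A_C ⊂ 𝒦`"; the `A`-half is the
PROVED crux `FarPastLedger` (stmt-14060, `FarPastLedger_proof`: `∫_{B_R(x₀)} ‖u(t)‖² ≤ K R`).

* `dissipation_window_le` — the local energy identity of the classical pair `(u, p)` on a window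
  (`IsClassicalNSSolutionOn.local_energy_identity_cutoff`) against the cut-off `φ₀(· − x₀)`
  between `s' ≤ t' < 0`, dissipation KEPT: word for word the landed linear flux ledger
  `stub_fplLinearFluxLedger` (`Theorems/SymmetryModuliCountFarPastLedgerLinearFluxLedger`; fluxes
  bounded slice-wise by `fpl_LFL_flux_slice_le` through the near/far pressure structure, the
  covering count and the far-shell sum), discarding `∫ φ|u(t')|² ≥ 0` instead of
  `2∫∫ |∇u|²_F φ ≥ 2∫∫_{B₁(x₀)} ‖∇u‖²`;
* `gradLedger_unit_window` — instantiated with the landed `stub_fplSlicePressure`,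
  `stub_fplFarShell`, `stub_fplCovering`, `nearFar_window`, `FarPastLedger_proof`
  (`F₀ = B = K`, window `(t'−2, 0)`, `s' = t'−1`): `∫_{t'−1}^{t'} ∫_{B₁(x₀)} ‖∇u‖² ≤ K_E`, `t' < 0`;
* `gradLedger_unit` — the vertex `t' = 0` by exhaustion (`scaledIntegral_vertex_zero`);
* `farPast_gradLedger` — all radii by zoom invariance (`isTypeIAncientMild_zoom`, `scaledGradEnergy_zoom`).

References: Caffarelli–Kohn–Nirenberg, CPAM 35 (1982) §2; D. Albritton, T. Barker,
arXiv:1811.00502 §1, Rem. 3.2 [AlbrittonBarker2019]; KNSS, Acta Math. 203 (2009) [KochNadirashviliSereginSverak2009].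
-/
noncomputable section

open MeasureTheory Set Filter Metric Topology Function
open Literature.Analysis.FluidPDE
open scoped Laplacian RealInnerProductSpace ContDiff

-- the summit and its single problem share the name (D-0017 nested layout)
set_option linter.dupNamespace false

namespace Summit.NavierStokesRegularity.NavierStokesRegularity.Theorems.AdaptedFrequencyConverges.BirkhoffRecurrentHull

open Summit.NavierStokesRegularity.NavierStokesRegularity.Theorems

/-- **The dissipation on the unit ball is dominated by the localised dissipation**: for a cut-off
`φ ≥ 0` with `φ = 1` on `B₁(x₀)` and a smooth slice `u(τ)`, `τ < 0`,
`∫_{B₁(x₀)} ‖∇u(τ)‖² ≤ ∫ |∇u(τ)|²_F φ` (operator norm `≤` Frobenius norm). [folklore] -/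
theorem setIntegral_ball_norm_fderiv_sq_le_dissipation {C : ℝ}
    {u : ℝ → EuclideanSpace ℝ (Fin 3) → EuclideanSpace ℝ (Fin 3)} (hu : IsTypeIAncientMild C u)
    {φ : EuclideanSpace ℝ (Fin 3) → ℝ} (hφ : ContDiff ℝ ∞ φ) (hφ0 : ∀ z, 0 ≤ φ z)
    {x₀ : EuclideanSpace ℝ (Fin 3)} (hφ1 : ∀ z ∈ ball x₀ 1, φ z = 1)
    (hφ2 : ∀ z, z ∉ ball x₀ 2 → φ z = 0) {τ : ℝ} (hτ : τ < 0) :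
    ∫ x in ball x₀ 1, ‖fderiv ℝ (u τ) x‖ ^ 2 ≤ ∫ z, frobeniusNormSq (fderiv ℝ (u τ) z) * φ z := by
  have hsm : ContDiff ℝ 1 (u τ) := (hu.contDiff_slice hτ).of_le (by norm_cast)
  have hDc : Continuous fun z => fderiv ℝ (u τ) z := hsm.continuous_fderiv one_ne_zero
  have hFc : Continuous fun z => frobeniusNormSq (fderiv ℝ (u τ) z) :=
    LerayHopfProofs.continuous_frobeniusNormSq.comp hDc
  have hint : Integrable (fun z => frobeniusNormSq (fderiv ℝ (u τ) z) * φ z) volume :=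
    (hFc.mul hφ.continuous).integrable_of_hasCompactSupport
      (fpl_LFL_hasCompactSupport fun z hz => by
        show frobeniusNormSq (fderiv ℝ (u τ) z) * φ z = 0
        rw [hφ2 z hz, mul_zero])
  calc ∫ x in ball x₀ 1, ‖fderiv ℝ (u τ) x‖ ^ 2
      ≤ ∫ x in ball x₀ 1, frobeniusNormSq (fderiv ℝ (u τ) x) * φ x := by
        refine setIntegral_mono_on (fpl_LFL_integrableOn_ball (hDc.norm.pow 2) x₀ 1)
          hint.integrableOn measurableSet_ball fun z hz => ?_
        rw [hφ1 z hz, mul_one]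
        exact norm_sq_le_frobeniusNormSq _
    _ ≤ ∫ z, frobeniusNormSq (fderiv ℝ (u τ) z) * φ z :=
        setIntegral_le_integral hint
          (Eventually.of_forall fun z => mul_nonneg (frobeniusNormSq_nonneg _) (hφ0 z))

/-- **Continuity in time of the local dissipation** `t ↦ ∫_{B_r(x₀)} ‖∇u(t)‖²` of a field of the
class on `t < 0` (the slice gradient is jointly continuous). [folklore] -/
theorem continuousOn_setIntegral_ball_norm_fderiv_sq {C : ℝ}
    {u : ℝ → EuclideanSpace ℝ (Fin 3) → EuclideanSpace ℝ (Fin 3)} (hu : IsTypeIAncientMild C u)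
    (x₀ : EuclideanSpace ℝ (Fin 3)) (r : ℝ) :
    ContinuousOn (fun t => ∫ x in ball x₀ r, ‖fderiv ℝ (u t) x‖ ^ 2) (Iio 0) :=
  continuousOn_setIntegral_ball_norm_sq_of_continuousOn (g := fun t x => fderiv ℝ (u t) x)
    isOpen_Iio (continuousOn_fderiv_slice_of_contDiffOn (hu.contDiffOn.of_le (by norm_cast))
      isOpen_Iio.uniqueDiffOn) x₀ r

/-! ### The window dissipation bound (local energy identity, dissipation kept) -/

/-- **Window dissipation bound.** For `u ∈ A_C`, a classical pair `(u, p)` on the window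
`(t₀, 0)` with the near/far pressure structure (`c₀`), the covering count and the far-shell sum
(`c_S`): if `F₀` majorises the unit-ball energies at time `s'` and `B ≥ 0` on `[s', t'] ⊂ (t₀, 0)`,
then `∫_{s'}^{t'} ∫_{B₁(x₀)} ‖∇u‖² ≤ N F₀ + N B ((t' − s') + C (√(−s') − √(−t')))`, `N = N(c₀, c_S)`
(local energy identity against `φ₀(· − x₀)`, fluxes by `fpl_LFL_flux_slice_le`; adapted from the
landed `stub_fplLinearFluxLedger`, dissipation kept). [cite: CaffarelliKohnNirenberg1982, §2 (2.5)] -/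
theorem dissipation_window_le :
    ∀ (c₀ cS : ℝ), ∃ N : ℝ, 0 ≤ N ∧
    ∀ (C : ℝ) (u : ℝ → EuclideanSpace ℝ (Fin 3) → EuclideanSpace ℝ (Fin 3)),
    IsTypeIAncientMild C u →
    ∀ (t₀ : ℝ) (p : ℝ → EuclideanSpace ℝ (Fin 3) → ℝ),
    IsClassicalNSSolutionOn (Set.Ioo t₀ 0) 1 0 u p →
    (∀ τ ∈ Set.Ioo t₀ 0, ∀ x₀ : EuclideanSpace ℝ (Fin 3),
      ∃ (c : ℝ) (p₁ p₂ : EuclideanSpace ℝ (Fin 3) → ℝ),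
      (∀ x ∈ Metric.ball x₀ 2, p τ x = c + p₁ x + p₂ x) ∧
      MeasureTheory.MemLp p₁ 2 MeasureTheory.volume ∧
      ∫ x, p₁ x ^ 2 ≤ c₀ * (C ^ 2 / (-τ)) * ∫ x in Metric.ball x₀ 4, ‖u τ x‖ ^ 2 ∧
      ∀ x ∈ Metric.ball x₀ 2, DifferentiableAt ℝ p₂ x ∧
        ‖fderiv ℝ p₂ x‖ ≤ c₀ * ∫ y in (Metric.ball x₀ 3)ᶜ, ‖u τ y‖ ^ 2 / ‖y - x₀‖ ^ 4) →
    (∀ (ρ : ℝ), 1 ≤ ρ → ∀ (g : EuclideanSpace ℝ (Fin 3) → ℝ), Continuous g → (∀ x, 0 ≤ g x) →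
      ∀ (B : ℝ) (x₁ : EuclideanSpace ℝ (Fin 3)),
      (∀ z : EuclideanSpace ℝ (Fin 3), ∫ x in Metric.ball z 1, g x ≤ B) →
      ∫ x in Metric.ball x₁ ρ, g x ≤ 125 * ρ ^ 3 * B) →
    (∀ (g : EuclideanSpace ℝ (Fin 3) → ℝ), Continuous g → (∀ x, 0 ≤ g x) → (∃ M : ℝ, ∀ x, g x ≤ M) →
      ∀ (B : ℝ) (x₁ : EuclideanSpace ℝ (Fin 3)),
      (∀ z : EuclideanSpace ℝ (Fin 3), ∫ x in Metric.ball z 1, g x ≤ B) →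
      MeasureTheory.IntegrableOn (fun y => g y / ‖y - x₁‖ ^ 4) (Metric.ball x₁ 3)ᶜ
          MeasureTheory.volume ∧
        ∫ y in (Metric.ball x₁ 3)ᶜ, g y / ‖y - x₁‖ ^ 4 ≤ cS * B) →
    ∀ (s' t' : ℝ), t₀ < s' → s' ≤ t' → t' < 0 → ∀ (F₀ B : ℝ), 0 ≤ B →
    (∀ z : EuclideanSpace ℝ (Fin 3), ∫ x in Metric.ball z 1, ‖u s' x‖ ^ 2 ≤ F₀) →
    (∀ τ ∈ Set.Icc s' t', ∀ z : EuclideanSpace ℝ (Fin 3), ∫ x in Metric.ball z 1, ‖u τ x‖ ^ 2 ≤ B) →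
    ∀ x₀ : EuclideanSpace ℝ (Fin 3),
      ∫ τ in s'..t', ∫ x in Metric.ball x₀ 1, ‖fderiv ℝ (u τ) x‖ ^ 2 ≤
        N * F₀ + N * B * ((t' - s') + C * (Real.sqrt (-s') - Real.sqrt (-t'))) := by
  -- adapted from `stub_fplLinearFluxLedger` (Theorems/SymmetryModuliCountFarPastLedgerLinearFluxLedger)
  intro c₀ cS
  obtain ⟨c₁, c₂, hc₁0, hc₂0, hcut⟩ := fpl_LFL_exists_cutoff
  obtain ⟨V, hVdef⟩ : ∃ V : ℝ, V = volume.real (ball (0 : EuclideanSpace ℝ (Fin 3)) 2) := ⟨_, rfl⟩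
  have hV0 : 0 ≤ V := by rw [hVdef]; exact measureReal_nonneg
  obtain ⟨K₀, hK₀def⟩ : ∃ K : ℝ, K = Real.sqrt (|c₀| * 8000 * (c₁ ^ 2 * 1000)) := ⟨_, rfl⟩
  have hK₀0 : 0 ≤ K₀ := by rw [hK₀def]; exact Real.sqrt_nonneg _
  obtain ⟨K₁, hK₁def⟩ : ∃ K : ℝ, K = 3375 * c₂ := ⟨_, rfl⟩
  obtain ⟨K₂, hK₂def⟩ : ∃ K : ℝ, K = 1000 * c₁ + 2 * K₀ + 4 * |c₀| * |cS| * c₁ * V := ⟨_, rfl⟩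
  have hK₁0 : 0 ≤ K₁ := by rw [hK₁def]; positivity
  have hK₂0 : 0 ≤ K₂ := by rw [hK₂def]; positivity
  refine ⟨1000 + K₁ + 2 * K₂, by positivity, ?_⟩
  intro C u hu t₀ p hNS hNF hCOV hSHELL s' t' hs' hst ht' F₀ B hB hF₀ hBτ x₀
  obtain ⟨φ, hφ, hφc, hφ0, hφ1, hφball1, hφ2, hφc₁, hφc₂⟩ := hcut x₀
  have hC0 : 0 ≤ C := hu.nonneg
  have hs'0 : s' < 0 := lt_of_le_of_lt hst ht'
  have hI : Icc s' t' ⊆ Ioo t₀ 0 := fun τ hτ => ⟨hs'.trans_le hτ.1, hτ.2.trans_lt ht'⟩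
  -- (a) the weighted energy at the exit time `t'` is nonnegative
  have ha : 0 ≤ ∫ x, φ x * ‖u t' x‖ ^ 2 :=
    integral_nonneg fun z => mul_nonneg (hφ0 z) (sq_nonneg _)
  -- (b) the entry deposit at time `s'`
  have hvs : Continuous (u s') := hu.continuous_slice hs'0
  have hb : ∫ x, φ x * ‖u s' x‖ ^ 2 ≤ 1000 * F₀ := by
    have h1 : ∫ x, φ x * ‖u s' x‖ ^ 2 ≤ 1 * ∫ x in ball x₀ 2, ‖u s' x‖ ^ 2 :=
      fpl_LFL_integral_le_mul_setIntegral
        (fpl_LFL_integrableOn_ball (hφ.continuous.mul (hvs.norm.pow 2)) x₀ 2)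
        (fpl_LFL_integrableOn_ball (hvs.norm.pow 2) x₀ 2)
        (fun z _ => mul_le_mul_of_nonneg_right (hφ1 z) (sq_nonneg _))
        (fun z hz => by rw [hφ2 z hz, zero_mul])
    have h2 : ∫ x in ball x₀ 2, ‖u s' x‖ ^ 2 ≤ 125 * 2 ^ 3 * F₀ :=
      hCOV 2 (by norm_num) (fun x => ‖u s' x‖ ^ 2) (hvs.norm.pow 2) (fun x => sq_nonneg _) F₀ x₀ hF₀
    linarith
  -- (c) the flux at each time `τ ∈ [s', t']`
  have hflux : ∀ τ ∈ Icc s' t',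
      ∫ z, (1 * ((Δ φ) z * ‖u τ z‖ ^ 2) + fderiv ℝ φ z (u τ z) * ‖u τ z‖ ^ 2 +
        2 * (p τ z * fderiv ℝ φ z (u τ z))) ≤ K₁ * B + K₂ * (C * B) * (Real.sqrt (-τ))⁻¹ := by
    intro τ hτ
    have hτS : τ ∈ Ioo t₀ 0 := hI hτ
    have hτ0 : τ < 0 := hτS.2
    have hnτ : 0 < -τ := by linarith
    have hsq : 0 < Real.sqrt (-τ) := Real.sqrt_pos.2 hnτ
    obtain ⟨M, hMdef⟩ : ∃ M : ℝ, M = C / Real.sqrt (-τ) := ⟨_, rfl⟩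
    have hM : 0 ≤ M := by rw [hMdef]; exact div_nonneg hC0 hsq.le
    have hvM : ∀ z, ‖u τ z‖ ≤ M := fun z => by rw [hMdef]; exact hu.norm_le hτ0 z
    have hv : Continuous (u τ) := hu.continuous_slice hτ0
    have hq : Continuous (p τ) := (hNS.contDiff_pressure hτS).continuous
    have hdiv : IsWeaklyDivFree (u τ) := hu.isWeaklyDivFree hτ0
    obtain ⟨c, p₁, p₂, hdec, hp₁, hX, hp₂⟩ := hNF τ hτS x₀
    have hg0 : ∀ x, 0 ≤ ‖u τ x‖ ^ 2 := fun x => sq_nonneg _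
    have hgc : Continuous fun x => ‖u τ x‖ ^ 2 := hv.norm.pow 2
    have hB2 : ∫ x in ball x₀ 2, ‖u τ x‖ ^ 2 ≤ 125 * 2 ^ 3 * B :=
      hCOV 2 (by norm_num) _ hgc hg0 B x₀ (hBτ τ hτ)
    have hB3 : ∫ x in ball x₀ 3, ‖u τ x‖ ^ 2 ≤ 125 * 3 ^ 3 * B :=
      hCOV 3 (by norm_num) _ hgc hg0 B x₀ (hBτ τ hτ)
    have hB4 : ∫ x in ball x₀ 4, ‖u τ x‖ ^ 2 ≤ 125 * 4 ^ 3 * B :=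
      hCOV 4 (by norm_num) _ hgc hg0 B x₀ (hBτ τ hτ)
    have hSh : ∫ y in (ball x₀ 3)ᶜ, ‖u τ y‖ ^ 2 / ‖y - x₀‖ ^ 4 ≤ cS * B :=
      (hSHELL _ hgc hg0 ⟨M ^ 2, fun x => pow_le_pow_left₀ (norm_nonneg _) (hvM x) 2⟩ B x₀
        (hBτ τ hτ)).2
    have hI0 : 0 ≤ ∫ y in (ball x₀ 3)ᶜ, ‖u τ y‖ ^ 2 / ‖y - x₀‖ ^ 4 :=
      setIntegral_nonneg measurableSet_ball.compl fun y _ => by positivity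
    have hL : c₀ * ∫ y in (ball x₀ 3)ᶜ, ‖u τ y‖ ^ 2 / ‖y - x₀‖ ^ 4 ≤ |c₀| * |cS| * B :=
      calc c₀ * ∫ y in (ball x₀ 3)ᶜ, ‖u τ y‖ ^ 2 / ‖y - x₀‖ ^ 4
          ≤ |c₀| * ∫ y in (ball x₀ 3)ᶜ, ‖u τ y‖ ^ 2 / ‖y - x₀‖ ^ 4 :=
            mul_le_mul_of_nonneg_right (le_abs_self _) hI0
        _ ≤ |c₀| * (cS * B) := mul_le_mul_of_nonneg_left hSh (abs_nonneg _)
        _ ≤ |c₀| * (|cS| * B) :=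
            mul_le_mul_of_nonneg_left (mul_le_mul_of_nonneg_right (le_abs_self _) hB)
              (abs_nonneg _)
        _ = |c₀| * |cS| * B := by ring
    have hVx : volume.real (ball x₀ 2) ≤ V := by
      rw [hVdef, Measure.addHaar_real_ball_center volume x₀ 2]
    have key := fpl_LFL_flux_slice_le hφ hφc hφ0 hφ2 hφc₁ hφc₂ hv hdiv hM hvM hq hdec hp₁ hp₂ hVx
    -- the near-pressure square roots
    have hXb : ∫ z, p₁ z ^ 2 ≤ |c₀| * 8000 * (C ^ 2 / (-τ)) * B := by
      refine hX.trans ?_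
      calc c₀ * (C ^ 2 / (-τ)) * ∫ x in ball x₀ 4, ‖u τ x‖ ^ 2
          ≤ |c₀| * (C ^ 2 / (-τ)) * ∫ x in ball x₀ 4, ‖u τ x‖ ^ 2 :=
            mul_le_mul_of_nonneg_right (mul_le_mul_of_nonneg_right (le_abs_self _)
              (by positivity)) (setIntegral_nonneg measurableSet_ball fun x _ => hg0 x)
        _ ≤ |c₀| * (C ^ 2 / (-τ)) * (125 * 4 ^ 3 * B) :=
            mul_le_mul_of_nonneg_left hB4 (by positivity)
        _ = |c₀| * 8000 * (C ^ 2 / (-τ)) * B := by ring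
    have hYb : c₁ ^ 2 * ∫ z in ball x₀ 2, ‖u τ z‖ ^ 2 ≤ c₁ ^ 2 * 1000 * B := by
      calc c₁ ^ 2 * ∫ z in ball x₀ 2, ‖u τ z‖ ^ 2 ≤ c₁ ^ 2 * (125 * 2 ^ 3 * B) :=
            mul_le_mul_of_nonneg_left hB2 (sq_nonneg _)
        _ = c₁ ^ 2 * 1000 * B := by ring
    have hsqrt := fpl_LFL_sqrt_mul_sqrt_le (integral_nonneg fun z => sq_nonneg _)
      (mul_nonneg (sq_nonneg _) (setIntegral_nonneg measurableSet_ball fun x _ => hg0 x))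
      (by positivity) (by positivity) hB hC0 hnτ hXb hYb
    rw [← hK₀def] at hsqrt
    -- the common factor `Q = C B (−τ)^{-1/2}`
    obtain ⟨Q, hQdef⟩ : ∃ Q : ℝ, Q = C * B * (Real.sqrt (-τ))⁻¹ := ⟨_, rfl⟩
    have hQ : C * B / Real.sqrt (-τ) = Q := by rw [hQdef, div_eq_mul_inv]
    have hMB : M * B = Q := by rw [hMdef, hQdef, div_eq_mul_inv]; ring
    rw [hQ] at hsqrt
    have e1 : c₂ * ∫ z in ball x₀ 3, ‖u τ z‖ ^ 2 ≤ K₁ * B :=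
      calc c₂ * ∫ z in ball x₀ 3, ‖u τ z‖ ^ 2 ≤ c₂ * (125 * 3 ^ 3 * B) :=
            mul_le_mul_of_nonneg_left hB3 hc₂0
        _ = K₁ * B := by rw [hK₁def]; ring
    have e2 : c₁ * M * ∫ z in ball x₀ 2, ‖u τ z‖ ^ 2 ≤ 1000 * c₁ * Q :=
      calc c₁ * M * ∫ z in ball x₀ 2, ‖u τ z‖ ^ 2 ≤ c₁ * M * (125 * 2 ^ 3 * B) :=
            mul_le_mul_of_nonneg_left hB2 (mul_nonneg hc₁0 hM)
        _ = 1000 * c₁ * (M * B) := by ring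
        _ = 1000 * c₁ * Q := by rw [hMB]
    have e3 : 2 * (Real.sqrt (∫ z, p₁ z ^ 2) *
        Real.sqrt (c₁ ^ 2 * ∫ z in ball x₀ 2, ‖u τ z‖ ^ 2)) ≤ 2 * K₀ * Q := by
      rw [mul_assoc 2 K₀ Q]
      exact mul_le_mul_of_nonneg_left hsqrt zero_le_two
    have e4 : 4 * (c₀ * ∫ y in (ball x₀ 3)ᶜ, ‖u τ y‖ ^ 2 / ‖y - x₀‖ ^ 4) * (c₁ * M) * V ≤
        4 * |c₀| * |cS| * c₁ * V * Q :=
      calc 4 * (c₀ * ∫ y in (ball x₀ 3)ᶜ, ‖u τ y‖ ^ 2 / ‖y - x₀‖ ^ 4) * (c₁ * M) * V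
          ≤ 4 * (|c₀| * |cS| * B) * (c₁ * M) * V :=
            mul_le_mul_of_nonneg_right (mul_le_mul_of_nonneg_right
              (mul_le_mul_of_nonneg_left hL (by norm_num)) (mul_nonneg hc₁0 hM)) hV0
        _ = 4 * |c₀| * |cS| * c₁ * V * (M * B) := by ring
        _ = 4 * |c₀| * |cS| * c₁ * V * Q := by rw [hMB]
    have eK : K₂ * (C * B) * (Real.sqrt (-τ))⁻¹ =
        1000 * c₁ * Q + 2 * K₀ * Q + 4 * |c₀| * |cS| * c₁ * V * Q := by
      rw [mul_assoc, ← hQdef, hK₂def]; ring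
    rw [eK]
    linarith [key, e1, e2, e3, e4]
  -- (d) integrate the energy identity in time, KEEP the dissipation
  have hId := hNS.local_energy_identity_cutoff isOpen_Ioo hφ hφc hst hI
  have hI' : uIcc s' t' ⊆ Ioo t₀ 0 := by rwa [uIcc_of_le hst]
  have hFint : IntervalIntegrable (fun τ => ∫ z, (1 * ((Δ φ) z * ‖u τ z‖ ^ 2) +
      fderiv ℝ φ z (u τ z) * ‖u τ z‖ ^ 2 + 2 * (p τ z * fderiv ℝ φ z (u τ z)))) volume s' t' :=
    ((hNS.continuousOn_integral_flux_cutoff hφ hφc).mono hI').intervalIntegrable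
  have hGint : IntervalIntegrable (fun τ => K₁ * B + K₂ * (C * B) * (Real.sqrt (-τ))⁻¹)
      volume s' t' :=
    intervalIntegrable_const.add ((fpl_LFL_intervalIntegrable_inv_sqrt s' t' hst ht').const_mul _)
  have hmono := intervalIntegral.integral_mono_on hst hFint hGint hflux
  have hG : ∫ τ in s'..t', (K₁ * B + K₂ * (C * B) * (Real.sqrt (-τ))⁻¹) =
      (t' - s') * (K₁ * B) + K₂ * (C * B) * (2 * (Real.sqrt (-s') - Real.sqrt (-t'))) := by
    rw [intervalIntegral.integral_add intervalIntegrable_const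
        ((fpl_LFL_intervalIntegrable_inv_sqrt s' t' hst ht').const_mul _),
      intervalIntegral.integral_const, intervalIntegral.integral_const_mul,
      fpl_LFL_integral_inv_sqrt s' t' hst ht', smul_eq_mul]
  rw [hG] at hmono
  -- (d') the unit-ball dissipation is dominated by the localised dissipation
  have hDint : IntervalIntegrable (fun τ => ∫ z, frobeniusNormSq (fderiv ℝ (u τ) z) * φ z)
      volume s' t' :=
    ((hNS.continuousOn_integral_dissipation_cutoff isOpen_Ioo hφ.continuous hφc).mono
      hI').intervalIntegrable
  have hEint : IntervalIntegrable (fun τ => ∫ x in ball x₀ 1, ‖fderiv ℝ (u τ) x‖ ^ 2)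
      volume s' t' :=
    ((continuousOn_setIntegral_ball_norm_fderiv_sq hu x₀ 1).mono
      fun τ hτ => (hI' hτ).2).intervalIntegrable
  have hcomp : ∫ τ in s'..t', ∫ x in ball x₀ 1, ‖fderiv ℝ (u τ) x‖ ^ 2 ≤
      ∫ τ in s'..t', ∫ z, frobeniusNormSq (fderiv ℝ (u τ) z) * φ z :=
    intervalIntegral.integral_mono_on hst hEint hDint fun τ hτ =>
      setIntegral_ball_norm_fderiv_sq_le_dissipation hu hφ hφ0 hφball1 hφ2
        (lt_of_le_of_lt hτ.2 ht')
  have hL0 : 0 ≤ ∫ τ in s'..t', ∫ x in ball x₀ 1, ‖fderiv ℝ (u τ) x‖ ^ 2 :=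
    intervalIntegral.integral_nonneg hst fun τ _ =>
      setIntegral_nonneg measurableSet_ball fun x _ => sq_nonneg _
  -- (e) conclude
  have hδ : 0 ≤ Real.sqrt (-s') - Real.sqrt (-t') :=
    sub_nonneg.2 (Real.sqrt_le_sqrt (by linarith))
  have hF₀0 : 0 ≤ F₀ :=
    (setIntegral_nonneg measurableSet_ball fun x _ => sq_nonneg _).trans (hF₀ x₀)
  have f1 : 1000 * F₀ ≤ (1000 + K₁ + 2 * K₂) * F₀ :=
    mul_le_mul_of_nonneg_right (by linarith) hF₀0
  have f2 : K₁ * (B * (t' - s')) ≤ (1000 + K₁ + 2 * K₂) * (B * (t' - s')) :=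
    mul_le_mul_of_nonneg_right (by linarith) (mul_nonneg hB (sub_nonneg.2 hst))
  have f3 : 2 * K₂ * (B * (C * (Real.sqrt (-s') - Real.sqrt (-t')))) ≤
      (1000 + K₁ + 2 * K₂) * (B * (C * (Real.sqrt (-s') - Real.sqrt (-t')))) :=
    mul_le_mul_of_nonneg_right (by linarith) (by positivity)
  linarith [ha, hb, hId, hmono, hcomp, hL0, f1, f2, f3]

/-! ### The gradient ledger at unit scale -/

/-- **The gradient ledger on unit windows.** For every `C` there is `K_E ≥ 0` with
`∫_{t'−1}^{t'} ∫_{B₁(x₀)} ‖∇u‖² ≤ K_E` for all `u ∈ A_C`, all `t' < 0` and all centres `x₀`: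
`dissipation_window_le` on the window `(t'−2, 0)` from `s' = t'−1`, fed with the landed slice
pressure lemma, far-shell sum, covering count, the near/far window pressure (`nearFar_window`) and
the far-past ledger `∫_{B₁(z)}‖u(τ)‖² ≤ K` (`FarPastLedger_proof`); `√(1−t') − √(−t') ≤ 1`.
[cite: AlbrittonBarker2019, Rem. 3.2] -/
theorem gradLedger_unit_window (C : ℝ) : ∃ KE : ℝ, 0 ≤ KE ∧
    ∀ u : ℝ → EuclideanSpace ℝ (Fin 3) → EuclideanSpace ℝ (Fin 3), IsTypeIAncientMild C u →
    ∀ t' < 0, ∀ x₀ : EuclideanSpace ℝ (Fin 3),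
      ∫ t in Ioo (t' - 1) t', ∫ x in ball x₀ 1, ‖fderiv ℝ (u t) x‖ ^ 2 ≤ KE := by
  obtain ⟨c₀, hc₀, hHA⟩ := stub_fplSlicePressure
  obtain ⟨cS, -, hS⟩ := stub_fplFarShell
  obtain ⟨N, hN, hL⟩ := dissipation_window_le c₀ cS
  obtain ⟨K, hK⟩ := FarPastLedger_proof C
  set K' : ℝ := max K 0 with hK'
  set C' : ℝ := max C 0 with hC'
  have hK'0 : 0 ≤ K' := le_max_right _ _
  have hC'0 : 0 ≤ C' := le_max_right _ _
  refine ⟨N * K' + N * K' * (1 + C'), by positivity, fun u hu t' ht' x₀ => ?_⟩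
  have hC0 : 0 ≤ C := hu.nonneg
  have hCC' : C = C' := (max_eq_left hC0).symm
  -- the window `(t' - 2, 0)`, entry time `s' = t' - 1`
  have ht₀ : t' - 2 < 0 := by linarith
  obtain ⟨p, hp, hNF⟩ := nearFar_window hHA hc₀ hu ht₀
  have hunit : ∀ τ < 0, ∀ z : EuclideanSpace ℝ (Fin 3), ∫ x in ball z 1, ‖u τ x‖ ^ 2 ≤ K' :=
    fun τ hτ z => ((hK u hu τ hτ z 1 one_pos).trans (by rw [mul_one])).trans (le_max_left _ _)
  have key := hL C u hu (t' - 2) p hp hNF stub_fplCovering (hS stub_fplCovering) (t' - 1) t'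
    (by linarith) (by linarith) ht' K' K' hK'0 (hunit _ (by linarith))
    (fun τ hτ z => hunit τ (lt_of_le_of_lt hτ.2 ht') z) x₀
  -- `√(1 - t') - √(-t') ≤ 1`
  have hsq : Real.sqrt (-(t' - 1)) - Real.sqrt (-t') ≤ 1 := by
    have ha : 0 ≤ -t' := by linarith
    have h1 : 0 ≤ Real.sqrt (-t') := Real.sqrt_nonneg _
    have h : Real.sqrt (-t' + 1) ≤ Real.sqrt (-t') + 1 :=
      calc Real.sqrt (-t' + 1) ≤ Real.sqrt ((Real.sqrt (-t') + 1) ^ 2) :=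
            Real.sqrt_le_sqrt (by nlinarith [Real.sq_sqrt ha])
        _ = Real.sqrt (-t') + 1 := Real.sqrt_sq (by positivity)
    rw [show -(t' - 1) = -t' + 1 by ring]
    linarith
  have hsq0 : 0 ≤ Real.sqrt (-(t' - 1)) - Real.sqrt (-t') :=
    sub_nonneg.2 (Real.sqrt_le_sqrt (by linarith))
  have hbound : N * K' + N * K' * ((t' - (t' - 1)) + C * (Real.sqrt (-(t' - 1)) - Real.sqrt (-t'))) ≤
      N * K' + N * K' * (1 + C') := by
    have h1 : C * (Real.sqrt (-(t' - 1)) - Real.sqrt (-t')) ≤ C' * 1 := by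
      rw [hCC']
      exact mul_le_mul_of_nonneg_left hsq hC'0
    have h2 : (t' - (t' - 1)) + C * (Real.sqrt (-(t' - 1)) - Real.sqrt (-t')) ≤ 1 + C' := by
      linarith
    exact add_le_add le_rfl (mul_le_mul_of_nonneg_left h2 (mul_nonneg hN hK'0))
  rw [intervalIntegral.integral_of_le (by linarith : t' - 1 ≤ t'), integral_Ioc_eq_integral_Ioo] at key
  exact key.trans hbound

/-- **The gradient ledger at unit scale, every top time `t₀ ≤ 0`** (the vertex `t₀ = 0` by
exhaustion, `scaledIntegral_vertex_zero`: the slice dissipation is continuous and nonnegative on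
`t < 0`). [folklore] -/
theorem gradLedger_unit (C : ℝ) : ∃ KE : ℝ, 0 ≤ KE ∧
    ∀ u : ℝ → EuclideanSpace ℝ (Fin 3) → EuclideanSpace ℝ (Fin 3), IsTypeIAncientMild C u →
    ∀ t₀ ≤ 0, ∀ x₀ : EuclideanSpace ℝ (Fin 3),
      ∫ t in Ioo (t₀ - 1) t₀, ∫ x in ball x₀ 1, ‖fderiv ℝ (u t) x‖ ^ 2 ≤ KE := by
  obtain ⟨KE, hKE, h⟩ := gradLedger_unit_window C
  refine ⟨KE, hKE, fun u hu t₀ ht₀ x₀ => ?_⟩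
  rcases lt_or_eq_of_le ht₀ with ht₀' | rfl
  · exact h u hu t₀ ht₀' x₀
  · have key := scaledIntegral_vertex_zero
      (Φ := fun t => ∫ x in ball x₀ 1, ‖fderiv ℝ (u t) x‖ ^ 2)
      (continuousOn_setIntegral_ball_norm_fderiv_sq hu x₀ 1)
      (fun t _ => setIntegral_nonneg measurableSet_ball fun x _ => sq_nonneg _) hKE one_pos
      (fun t ht => by
        rw [inv_one, one_mul, one_pow]
        exact h u hu t ht x₀)
    rw [inv_one, one_mul, one_pow] at key
    simpa only [zero_sub] using key

/-! ### The gradient ledger at every scale -/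

/-- **The far-past GRADIENT ledger of `A_C`.** For every `C` there is `K_E ≥ 0` such that every
`u ∈ A_C` satisfies `r⁻¹ ∫_{t₀−r²}^{t₀} ∫_{B_r(x₀)} ‖∇u‖² ≤ K_E` for all centres `x₀`, all top
times `t₀ ≤ 0` and all radii `r > 0`: the cylinder `Q_r(t₀, x₀)` is the unit cylinder
`Q_1(t₀/r², 0)` of the zoom `r u(r²·, x₀ + r·) ∈ A_C` (`isTypeIAncientMild_zoom`,
`scaledGradEnergy_zoom`), where `gradLedger_unit` applies. [cite: AlbrittonBarker2019, §1 and Rem. 3.2] -/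
theorem farPast_gradLedger :
    ∀ C : ℝ, ∃ KE : ℝ, 0 ≤ KE ∧
    ∀ u : ℝ → EuclideanSpace ℝ (Fin 3) → EuclideanSpace ℝ (Fin 3),
    Literature.Analysis.FluidPDE.IsTypeIAncientMild C u →
    ∀ (x₀ : EuclideanSpace ℝ (Fin 3)) (t₀ r : ℝ), t₀ ≤ 0 → 0 < r →
      r⁻¹ * ∫ t in Set.Ioo (t₀ - r ^ 2) t₀, ∫ x in Metric.ball x₀ r, ‖fderiv ℝ (u t) x‖ ^ 2 ≤ KE := by
  intro C
  obtain ⟨KE, hKE, h⟩ := gradLedger_unit C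
  refine ⟨KE, hKE, fun u hu x₀ t₀ r ht₀ hr => ?_⟩
  have hr0 : r ≠ 0 := hr.ne'
  have hd : ∀ t < 0, Differentiable ℝ (u t) := fun t ht =>
    (hu.contDiff_slice ht).differentiable (by simp)
  set s₀ : ℝ := t₀ / r ^ 2 with hs₀
  have hs₀0 : s₀ ≤ 0 := div_nonpos_of_nonpos_of_nonneg ht₀ (sq_nonneg r)
  have key := scaledGradEnergy_zoom hr x₀ (0 : EuclideanSpace ℝ (Fin 3)) u hd hs₀0 one_pos
  have e1 : r ^ 2 * s₀ = t₀ := by rw [hs₀]; field_simp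
  rw [inv_one, one_mul, one_pow, mul_one, smul_zero, add_zero, e1] at key
  rw [← key]
  exact h _ (isTypeIAncientMild_zoom hu hr x₀) s₀ hs₀0 0

end Summit.NavierStokesRegularity.NavierStokesRegularity.Theorems.AdaptedFrequencyConverges.BirkhoffRecurrentHull

end
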